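import Mathlib
import HarnessLib
import Summits.NavierStokesRegularity.NavierStokesRegularity.Theorems.PoloidalWindowDoorPoloidalWindowRigidityRealKernels
import Summits.NavierStokesRegularity.NavierStokesRegularity.Theorems.PoloidalWindowDoorPoloidalWindowRigidityReversePoincare
import Summits.NavierStokesRegularity.NavierStokesRegularity.Theorems.PoloidalWindowDoorPoloidalWindowRigidityThmAAssembly

/-!
# Theorem A: the semi-elliptic (TH) Liouville theorem without slope bounds

Seat ns-poloidal-K2-p2 g6 (interim lead-of-record on crux K2 `PoloidalWindowRigidity` = stmt-NavierStokesRegularity-19708;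
line `mixed_type` v1; item stmt-20428 `LrcModEntire`).  File 4c — the capstone of the Lean port of **Theorem A** of
memo TH-ELLIPTIC-LIOUVILLE-g6:

* `fderiv_eq_zero_of_sliceEquation` — **THEOREM A.**  Let `dim E < 4` and let `w, wz, wzz : ℝ → E → ℝ` be a bounded
  `C²_b` family (bounds on `w, Dw, D²w, ∇w, D∇w, div∇w, wz, wzz`), `∂_z w = wz`, `∂_z wz = wzz`, `z ↦ wzz(z,x)`
  continuous, solving the (TH) slice equation `wzz(z,·) = −Λ(z) div ∇ w(z,·)` for all `z ∉ F` (`Fᶜ` dense) with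
  `Λ ≥ 0` and `Λ(z₁) > 0` at one `z₁ ∉ F`.  Then `D w(z,·) ≡ 0` for every `z`: each slice is constant.

Assembly: for `0 < ε < N` the annular kernel `φ_{ε,N}` (Files 4a/4a′) carries the reproduction identity, hence
(File 4b) the σ-uniform weighted reverse Poincaré inequality, hence (File 5b) `w(z,·) ⋆ φ_{ε,N} ≡ 0`.  Writing
`φ_{ε,N} = β_N − β_ε` with `β_c(y) = c^d β(cy)`, `∫ β = 1` (`kerφ_eq_beta_sub`), the function `c ↦ (w ⋆ β_c)(x)` is
constant on `(0, ∞)`; letting `c → ∞` (approximate identity) it equals `w(x)`, so `w = w ⋆ β_c` for every `c > 0`, and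
moving the derivative onto the kernel, `|D w(x) v| ≤ ‖w‖_∞ · c · ‖∂_v β‖_{L¹}` for every `c > 0`, i.e. `Dw = 0`.
Consumer: the class corollary (mixed_type `stub_semiElliptic` ∩ (TH); K2-p3's local form) — next file.
WHAT THIS IS NOT: not a claim about Navier–Stokes — a kinematic Liouville theorem for the (TH) slice equation
(bears_on LADDER-NS N0 via crux K2 = stmt-19708 / item 20428).
-/

-- the summit and its single sub-problem share the name (CONVENTIONS §1)
set_option linter.dupNamespace false

noncomputable section

namespace Summit.NavierStokesRegularity.NavierStokesRegularity.Theorems.PoloidalWindowDoorPoloidalWindowRigidityThmA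

open Set Function Filter Topology MeasureTheory SchwartzMap Complex Real InnerProductSpace
open scoped RealInnerProductSpace FourierTransform ComplexConjugate
open Summit.NavierStokesRegularity.NavierStokesRegularity.Theorems.PoloidalWindowDoorPoloidalWindowRigidityFourierKernels
open Summit.NavierStokesRegularity.NavierStokesRegularity.Theorems.PoloidalWindowDoorPoloidalWindowRigidityRealKernels
open Summit.NavierStokesRegularity.NavierStokesRegularity.Theorems.PoloidalWindowDoorPoloidalWindowRigidityReversePoincare
open Summit.NavierStokesRegularity.NavierStokesRegularity.Theorems.PoloidalWindowDoorPoloidalWindowRigidityHorizontalConvolution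
open Summit.NavierStokesRegularity.NavierStokesRegularity.Theorems.PoloidalWindowDoorPoloidalWindowRigidityThmAAssembly

variable (V : Type*) [NormedAddCommGroup V] [InnerProductSpace ℝ V] [FiniteDimensional ℝ V]
  [MeasurableSpace V] [BorelSpace V]

/-! ### Real parts of Schwartz functions -/

section ReS

variable {V}

/-- `Re f` is integrable for Schwartz `f`. -/
theorem integrable_re (f : 𝓢(V, ℂ)) : Integrable fun y => (f y).re :=
  (f.integrable (μ := (volume : Measure V))).re

omit [FiniteDimensional ℝ V] [MeasurableSpace V] [BorelSpace V] in
/-- `Re f` is differentiable for Schwartz `f`. -/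
theorem differentiable_re (f : 𝓢(V, ℂ)) : Differentiable ℝ fun y => (f y).re :=
  Complex.reCLM.differentiable.comp f.differentiable

omit [FiniteDimensional ℝ V] [MeasurableSpace V] [BorelSpace V] in
/-- The derivative of `Re f`. -/
theorem fderiv_re (f : 𝓢(V, ℂ)) (x v : V) : fderiv ℝ (fun y => (f y).re) x v = (fderiv ℝ (⇑f) x v).re := by
  have : (fun y => (f y).re) = Complex.reCLM ∘ ⇑f := rfl
  rw [this, fderiv_comp x Complex.reCLM.differentiableAt f.differentiableAt, Complex.reCLM.fderiv]
  rfl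

open scoped LineDeriv in
/-- `∂_v Re f` is integrable. -/
theorem integrable_fderiv_re (f : 𝓢(V, ℂ)) (v : V) : Integrable fun s => fderiv ℝ (fun y => (f y).re) s v := by
  have : (fun s => fderiv ℝ (fun y => (f y).re) s v) = fun s => ((∂_{v} f) s).re := by
    ext s; rw [fderiv_re, lineDerivOp_apply_eq_fderiv]
  rw [this]
  exact ((∂_{v} f).integrable (μ := (volume : Measure V))).re

omit [FiniteDimensional ℝ V] [MeasurableSpace V] [BorelSpace V] in
open scoped LineDeriv in
/-- `∂_v Re f` is continuous. -/
theorem continuous_fderiv_re (f : 𝓢(V, ℂ)) (v : V) : Continuous fun s => fderiv ℝ (fun y => (f y).re) s v := by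
  have : (fun s => fderiv ℝ (fun y => (f y).re) s v) = fun s => ((∂_{v} f) s).re := by
    ext s; rw [fderiv_re, lineDerivOp_apply_eq_fderiv]
  rw [this]
  exact Complex.continuous_re.comp (∂_{v} f).continuous

end ReS

/-! ### The bumps `β_c` and the decomposition `φ_{ε,N} = β_N − β_ε` -/

omit [MeasurableSpace V] [BorelSpace V] in
/-- The complexified bump `χ(ξ/c) = bumpR c (2c)` has compact support (`c > 0`). -/
theorem hasCompactSupport_bumpC {c : ℝ} (hc : 0 < c) : HasCompactSupport fun ξ : V => (bumpR c (2 * c) ξ : ℂ) := by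
  refine HasCompactSupport.of_support_subset_isCompact (isCompact_closedBall (0 : V) (2 * c)) fun ξ hξ => ?_
  rw [mem_closedBall_zero_iff]
  by_contra h
  exact hξ (by simp only [bumpR_eq_zero (by linarith) hc.le (not_le.mp h).le, Complex.ofReal_zero])

/-- The scaled bump symbol `χ(ξ/c) = bumpR c (2c)` as a complex Schwartz function (`c > 0`). -/
def bumpS {c : ℝ} (hc : 0 < c) : 𝓢(V, ℂ) :=
  (hasCompactSupport_bumpC V hc).toSchwartzMap (Complex.ofRealCLM.contDiff.comp (contDiff_bumpR c (2 * c)))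

/-- The unit bump kernel `β := Re 𝓕⁻¹ χ`. -/
def betaOne : V → ℝ := fun y => ((𝓕⁻ (bumpS V one_pos) : 𝓢(V, ℂ)) y).re

/-- The rescaled kernels `β_c(y) = c^d β(c y)`. -/
def beta (c : ℝ) (y : V) : ℝ := c ^ Module.finrank ℝ V * betaOne V (c • y)

variable {V}

omit [MeasurableSpace V] [BorelSpace V] in
/-- Pointwise value of `bumpS`. -/
theorem bumpS_apply {c : ℝ} (hc : 0 < c) (ξ : V) : bumpS V hc ξ = (bumpR c (2 * c) ξ : ℂ) := rfl

omit [MeasurableSpace V] [BorelSpace V] in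
/-- `bumpS c = bumpS 1 (·/c)`. -/
theorem bumpS_eq_comp {c : ℝ} (hc : 0 < c) (ξ : V) : bumpS V hc ξ = bumpS V one_pos (c⁻¹ • ξ) := by
  rw [bumpS_apply, bumpS_apply]
  have := bumpR_smul (r := 1) (R := 2 * 1) hc ξ
  rw [mul_one, show c * (2 * 1) = 2 * c by ring] at this
  rw [this]

/-- Scaling of the inverse Fourier transform: `𝓕⁻¹[F(·/c)](y) = c^d 𝓕⁻¹F(cy)`. -/
theorem fourierInv_comp_inv_smul (F : V → ℂ) {c : ℝ} (hc : 0 < c) (y : V) :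
    𝓕⁻ (fun ξ => F (c⁻¹ • ξ)) y = (c ^ Module.finrank ℝ V : ℝ) • 𝓕⁻ F (c • y) := by
  rw [Real.fourierInv_eq, Real.fourierInv_eq,
    ← Measure.integral_comp_inv_smul_of_nonneg volume (fun ξ : V => 𝐞 ⟪ξ, c • y⟫ • F ξ) hc.le]
  congr 1
  ext ξ
  rw [real_inner_smul_left, real_inner_smul_right]
  congr 2
  field_simp

/-- `Re 𝓕⁻¹(bumpS c)(y) = β_c(y)`. -/
theorem re_fourierInv_bumpS {c : ℝ} (hc : 0 < c) (y : V) :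
    ((𝓕⁻ (bumpS V hc) : 𝓢(V, ℂ)) y).re = beta V c y := by
  rw [fourierInv_coe, show (⇑(bumpS V hc) : V → ℂ) = fun ξ => bumpS V one_pos (c⁻¹ • ξ) from
    funext (bumpS_eq_comp hc), fourierInv_comp_inv_smul _ hc, beta, betaOne, fourierInv_coe, Complex.smul_re,
    smul_eq_mul]

omit [MeasurableSpace V] [BorelSpace V] in
/-- The symbol decomposition `A_{ε,N} = χ(·/N) − χ(·/ε)` in Schwartz space. -/
theorem symAS_eq_sub {ε N : ℝ} (hε : 0 < ε) (hN : ε < N) :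
    symAS V hε hN = bumpS V (hε.trans hN) - bumpS V hε := by
  ext ξ
  rw [symAS_apply, sub_apply, bumpS_apply, bumpS_apply, symA]
  push_cast
  ring

/-- **`φ_{ε,N} = β_N − β_ε`.** -/
theorem kerφ_eq_beta_sub {ε N : ℝ} (hε : 0 < ε) (hN : ε < N) (y : V) :
    kerφ V hε hN y = beta V N y - beta V ε y := by
  rw [kerφ, PhiS, symAS_eq_sub hε hN]
  have := map_sub (FourierTransform.fourierInvₗ ℂ (𝓢(V, ℂ))) (bumpS V (hε.trans hN)) (bumpS V hε)
  simp only [FourierTransform.fourierInvₗ_apply] at this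
  rw [this, sub_apply, Complex.sub_re, re_fourierInv_bumpS, re_fourierInv_bumpS]

/-! ### Properties of `β` -/

/-- `β` is integrable. -/
theorem integrable_betaOne : Integrable (betaOne V) := integrable_re _

/-- `β` is continuous. -/
theorem continuous_betaOne : Continuous (betaOne V) :=
  Complex.continuous_re.comp (𝓕⁻ (bumpS V one_pos) : 𝓢(V, ℂ)).continuous

/-- `β` is differentiable. -/
theorem differentiable_betaOne : Differentiable ℝ (betaOne V) := differentiable_re _

/-- `∂_v β` is integrable. -/
theorem integrable_fderiv_betaOne (v : V) : Integrable fun s => fderiv ℝ (betaOne V) s v := integrable_fderiv_re _ v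

/-- `∂_v β` is continuous. -/
theorem continuous_fderiv_betaOne (v : V) : Continuous fun s => fderiv ℝ (betaOne V) s v :=
  continuous_fderiv_re _ v

/-- `∫ β = 1` (`= χ(0)`). -/
theorem integral_betaOne : ∫ y, betaOne V y = 1 := by
  unfold betaOne
  have hi : Integrable (⇑(𝓕⁻ (bumpS V one_pos) : 𝓢(V, ℂ))) (volume : Measure V) := SchwartzMap.integrable _
  have h1 := integral_re hi
  simp only [RCLike.re_eq_complex_re] at h1
  rw [h1]
  have h2 : ∫ y, (𝓕⁻ (bumpS V one_pos) : 𝓢(V, ℂ)) y = (𝓕 (𝓕⁻ (bumpS V one_pos) : 𝓢(V, ℂ))) 0 := by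
    rw [fourier_coe, Real.fourier_eq]
    simp
  rw [h2, FourierTransform.fourier_fourierInv_eq, bumpS_apply, bumpR_eq_one (by norm_num) zero_le_one (by simp)]
  simp

/-- `β_c` is continuous. -/
theorem continuous_beta (c : ℝ) : Continuous (beta V c) :=
  continuous_const.mul ((continuous_betaOne).comp (continuous_const.smul continuous_id))

/-- The derivative of `β_c`: `∂_v β_c(y) = c^{d+1} ∂_v β(cy)`. -/
theorem hasFDerivAt_beta (c : ℝ) (y : V) :
    HasFDerivAt (beta V c) ((c ^ Module.finrank ℝ V) • ((fderiv ℝ (betaOne V) (c • y)).comp (c • ContinuousLinearMap.id ℝ V))) y := by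
  have h1 : HasFDerivAt (fun y : V => c • y) (c • ContinuousLinearMap.id ℝ V) y := (hasFDerivAt_id y).const_smul c
  have h2 := ((differentiable_betaOne (V := V)) (c • y)).hasFDerivAt.comp y h1
  exact h2.const_mul (c ^ Module.finrank ℝ V)

/-- `∂_v β_c(y) = c^{d+1} ∂_v β(cy)`. -/
theorem fderiv_beta (c : ℝ) (y v : V) :
    fderiv ℝ (beta V c) y v = c ^ Module.finrank ℝ V * (c * fderiv ℝ (betaOne V) (c • y) v) := by
  rw [(hasFDerivAt_beta c y).fderiv]
  simp

/-- `β_c` is differentiable. -/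
theorem differentiable_beta (c : ℝ) : Differentiable ℝ (beta V c) := fun y => (hasFDerivAt_beta c y).differentiableAt

/-- `β_c` is integrable (`c > 0`). -/
theorem integrable_beta {c : ℝ} (hc : 0 < c) : Integrable (beta V c) := by
  unfold beta
  refine Integrable.const_mul ?_ _
  exact (integrable_betaOne (V := V)).comp_smul hc.ne'

/-- `∂_v β_c` is integrable (`c > 0`). -/
theorem integrable_fderiv_beta {c : ℝ} (hc : 0 < c) (v : V) : Integrable fun s => fderiv ℝ (beta V c) s v := by
  simp_rw [fderiv_beta]
  refine Integrable.const_mul (Integrable.const_mul ?_ _) _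
  exact (integrable_fderiv_betaOne (V := V) v).comp_smul hc.ne'

/-- `∫ |∂_v β_c| = c ∫ |∂_v β|` (`c > 0`). -/
theorem integral_abs_fderiv_beta {c : ℝ} (hc : 0 < c) (v : V) :
    ∫ y, |fderiv ℝ (beta V c) y v| = c * ∫ u, |fderiv ℝ (betaOne V) u v| := by
  simp_rw [fderiv_beta, abs_mul, abs_of_pos hc, abs_of_pos (pow_pos hc _)]
  rw [integral_const_mul, integral_const_mul,
    Measure.integral_comp_smul_of_nonneg volume (fun u => |fderiv ℝ (betaOne V) u v|) c (hR := hc.le),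
    smul_eq_mul]
  have : (c ^ Module.finrank ℝ V : ℝ) ≠ 0 := pow_ne_zero _ hc.ne'
  field_simp

/-! ### The approximate identity `w ⋆ β_c → w` (`c → ∞`) -/

/-- `(W ⋆ β_c)(x) = ∫ β(u) W(x − u/c) du` (`c > 0`). -/
theorem hconv_beta_eq {W : V → ℝ} {c : ℝ} (hc : 0 < c) (x : V) :
    hconv W (beta V c) x = ∫ u, betaOne V u * W (x - c⁻¹ • u) := by
  unfold hconv beta
  have h := Measure.integral_comp_smul_of_nonneg volume (fun u => betaOne V u * W (x - c⁻¹ • u)) c (hR := hc.le)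
  have hc0 : (c ^ Module.finrank ℝ V : ℝ) ≠ 0 := pow_ne_zero _ hc.ne'
  calc ∫ y, (c ^ Module.finrank ℝ V * betaOne V (c • y)) • W (x - y)
      = c ^ Module.finrank ℝ V * ∫ y, betaOne V (c • y) * W (x - c⁻¹ • c • y) := by
        rw [← integral_const_mul]
        congr 1
        ext y
        rw [smul_smul, inv_mul_cancel₀ hc.ne', one_smul, smul_eq_mul, mul_assoc]
    _ = ∫ u, betaOne V u * W (x - c⁻¹ • u) := by
        rw [h, smul_eq_mul, ← mul_assoc, mul_inv_cancel₀ hc0, one_mul]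

/-- **Approximate identity**: `(W ⋆ β_c)(x) → W(x)` as `c → ∞`, for bounded continuous `W`. -/
theorem tendsto_hconv_beta {W : V → ℝ} (hW : Continuous W) {M : ℝ} (hM : ∀ x, ‖W x‖ ≤ M) (x : V) :
    Tendsto (fun c : ℝ => hconv W (beta V c) x) atTop (𝓝 (W x)) := by
  have hev : (fun c : ℝ => hconv W (beta V c) x) =ᶠ[atTop] fun c => ∫ u, betaOne V u * W (x - c⁻¹ • u) := by
    filter_upwards [eventually_gt_atTop 0] with c hc using hconv_beta_eq hc x
  refine (tendsto_congr' hev).mpr ?_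
  have hlim : W x = ∫ u, betaOne V u * W x := by
    rw [integral_mul_const, integral_betaOne, one_mul]
  rw [hlim]
  refine tendsto_integral_filter_of_dominated_convergence (fun u => |betaOne V u| * M) ?_ ?_
    ((integrable_betaOne (V := V)).abs.mul_const M) ?_
  · exact Eventually.of_forall fun c => ((continuous_betaOne).mul
      (hW.comp (continuous_const.sub (continuous_const.smul continuous_id)))).aestronglyMeasurable
  · refine Eventually.of_forall fun c => Eventually.of_forall fun u => ?_
    rw [norm_mul, Real.norm_eq_abs]
    exact mul_le_mul_of_nonneg_left (hM _) (abs_nonneg _)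
  · refine Eventually.of_forall fun u => (tendsto_const_nhds.mul ((hW.tendsto _).comp ?_))
    have : Tendsto (fun c : ℝ => x - c⁻¹ • u) atTop (𝓝 (x - (0 : ℝ) • u)) :=
      tendsto_const_nhds.sub (tendsto_inv_atTop_zero.smul_const u)
    simpa using this

/-! ### The ending: `w ⋆ φ_{ε,N} ≡ 0` for all `0 < ε < N` forces `Dw ≡ 0` -/

/-- `W ⋆ φ_{ε,N} = W ⋆ β_N − W ⋆ β_ε`. -/
theorem hconv_kerφ_eq_sub {W : V → ℝ} (hW : Continuous W) {M : ℝ} (hM : ∀ x, ‖W x‖ ≤ M)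
    {ε N : ℝ} (hε : 0 < ε) (hN : ε < N) (x : V) :
    hconv W (kerφ V hε hN) x = hconv W (beta V N) x - hconv W (beta V ε) x := by
  unfold hconv
  rw [← integral_sub (integrable_smul_shift hW hM (integrable_beta (hε.trans hN)) x)
    (integrable_smul_shift hW hM (integrable_beta hε) x)]
  congr 1
  ext y
  rw [kerφ_eq_beta_sub, sub_smul]

/-- **The ending.**  If `W ∈ C¹` is bounded with bounded derivative and `W ⋆ φ_{ε,N} ≡ 0` for all `0 < ε < N`,
then `DW ≡ 0`. -/
theorem fderiv_eq_zero_of_hconv_kerφ_eq_zero {W : V → ℝ} (hW : ContDiff ℝ 1 W) {M : ℝ}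
    (hM0 : ∀ x, ‖W x‖ ≤ M) (hM1 : ∀ x, ‖fderiv ℝ W x‖ ≤ M)
    (h : ∀ ⦃ε N : ℝ⦄ (hε : 0 < ε) (hN : ε < N) (x : V), hconv W (kerφ V hε hN) x = 0) (x : V) :
    fderiv ℝ W x = 0 := by
  have hWc : Continuous W := hW.continuous
  have hDWc : Continuous (fderiv ℝ W) := hW.continuous_fderiv one_ne_zero
  have hM : 0 ≤ M := (norm_nonneg _).trans (hM0 x)
  -- Step 1: `c ↦ (W ⋆ β_c)(x')` is constant on `(0, ∞)`
  have hind : ∀ c c', 0 < c → 0 < c' → ∀ x', hconv W (beta V c) x' = hconv W (beta V c') x' := by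
    intro c c' hc hc' x'
    rcases lt_trichotomy c c' with hlt | heq | hgt
    · have := h hc hlt x'
      rw [hconv_kerφ_eq_sub hWc hM0 hc hlt] at this
      linarith
    · rw [heq]
    · have := h hc' hgt x'
      rw [hconv_kerφ_eq_sub hWc hM0 hc' hgt] at this
      linarith
  -- Step 2: `W ⋆ β_c = W`
  have hWeq : ∀ c, 0 < c → ∀ x', hconv W (beta V c) x' = W x' := by
    intro c hc x'
    have ht := tendsto_hconv_beta hWc hM0 x'
    have hev : (fun _ : ℝ => hconv W (beta V c) x') =ᶠ[atTop] fun c' => hconv W (beta V c') x' := by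
      filter_upwards [eventually_gt_atTop 0] with c' hc'' using hind c c' hc hc'' x'
    exact tendsto_nhds_unique (tendsto_const_nhds.congr' hev) ht
  -- Step 3: derivative bound `|DW(x) v| ≤ M c ∫ |∂_v β|`
  set I : V → ℝ := fun v => ∫ u, |fderiv ℝ (betaOne V) u v| with hI
  have hI0 : ∀ v, 0 ≤ I v := fun v => integral_nonneg fun u => abs_nonneg _
  have hD : ∀ c, 0 < c → ∀ v, |fderiv ℝ W x v| ≤ M * (c * I v) := by
    intro c hc v
    have hWfun : W = hconv W (beta V c) := (funext (hWeq c hc)).symm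
    have h1 : fderiv ℝ W x v = fderiv ℝ (hconv W (beta V c)) x v := by rw [← hWfun]
    rw [h1, fderiv_hconv hW hM0 hM1 (integrable_beta hc)]
    unfold hconv
    rw [ContinuousLinearMap.integral_apply (integrable_smul_shift hDWc hM1 (integrable_beta hc) x) v]
    simp only [_root_.FunLike.coe_smul, Pi.smul_apply, smul_eq_mul]
    rw [integral_mul_fderiv_shift_eq (integrable_beta hc) (differentiable_beta c) (integrable_fderiv_beta hc v)
      hW hM0 hM1 x, ← integral_abs_fderiv_beta hc v, ← Real.norm_eq_abs]
    have hb : ∀ y, ‖fderiv ℝ (beta V c) y v * W (x - y)‖ ≤ |fderiv ℝ (beta V c) y v| * M := fun y => by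
      rw [norm_mul, Real.norm_eq_abs]
      exact mul_le_mul_of_nonneg_left (hM0 _) (abs_nonneg _)
    refine (norm_integral_le_of_norm_le ((integrable_fderiv_beta hc v).abs.mul_const M)
      (Eventually.of_forall hb)).trans (le_of_eq ?_)
    rw [integral_mul_const, mul_comm]
  -- Step 4: conclude
  ext v
  have habs : |fderiv ℝ W x v| ≤ 0 := by
    refine le_of_forall_pos_le_add fun δ hδ => ?_
    have hpos : 0 < M * I v + 1 := by nlinarith [hI0 v]
    have := hD (δ / (M * I v + 1)) (div_pos hδ hpos) v
    rw [zero_add]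
    refine this.trans ?_
    rw [show M * (δ / (M * I v + 1) * I v) = δ * (M * I v / (M * I v + 1)) by ring]
    refine (mul_le_mul_of_nonneg_left ((div_le_one hpos).mpr (by linarith)) hδ.le).trans (le_of_eq (mul_one δ))
  have : fderiv ℝ W x v = 0 := abs_nonpos_iff.mp habs
  simpa using this

/-! ### Theorem A -/

/-- **THEOREM A (semi-elliptic (TH) Liouville without slope bounds).**  `dim E < 4`; `w, wz, wzz : ℝ → E → ℝ`
with, for every height `z`: `w(z,·) ∈ C²` and `w, Dw, D²w, ∇w, D∇w, div∇w` bounded by `M`; `wz(z,·)`, `wzz(z,·)`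
continuous and bounded by `M`; `∂_z w = wz`, `∂_z wz = wzz` pointwise, `z ↦ wzz(z,x)` continuous; the slice equation
`wzz(z,x) = −Λ(z)·div∇w(z,·)(x)` for `z ∉ F` (`Fᶜ` dense), `Λ ≥ 0`, `Λ(z₁) > 0`, `z₁ ∉ F`.
Then `D w(z,·) ≡ 0` for every `z` (every slice is constant). [folklore] -/
theorem fderiv_eq_zero_of_sliceEquation {E : Type*} [NormedAddCommGroup E] [InnerProductSpace ℝ E]
    [FiniteDimensional ℝ E] [MeasurableSpace E] [BorelSpace E] (hE : Module.finrank ℝ E < 4)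
    (w wz wzz : ℝ → E → ℝ) (Λ : ℝ → ℝ) (F : Set ℝ) {M : ℝ} {z₁ : ℝ}
    (hw2 : ∀ z, ContDiff ℝ 2 (w z))
    (hb0 : ∀ z x, ‖w z x‖ ≤ M) (hb1 : ∀ z x, ‖fderiv ℝ (w z) x‖ ≤ M) (hb2 : ∀ z x, ‖fderiv ℝ (fderiv ℝ (w z)) x‖ ≤ M)
    (hg0 : ∀ z x, ‖gradient (w z) x‖ ≤ M) (hg1 : ∀ z x, ‖fderiv ℝ (gradient (w z)) x‖ ≤ M)
    (hdiv : ∀ z x, |Literature.Analysis.FluidPDE.VectorCalculus.divergence (gradient (w z)) x| ≤ M)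
    (hwzc : ∀ z, Continuous (wz z)) (hwzzc : ∀ z, Continuous (wzz z)) (hwzzcz : ∀ x, Continuous fun z => wzz z x)
    (hbz : ∀ z x, |wz z x| ≤ M) (hbzz : ∀ z x, |wzz z x| ≤ M)
    (hd1 : ∀ x z, HasDerivAt (fun s => w s x) (wz z x) z) (hd2 : ∀ x z, HasDerivAt (fun s => wz s x) (wzz z x) z)
    (hF : Dense Fᶜ) (hΛ : ∀ z, 0 ≤ Λ z) (hz₁ : z₁ ∉ F) (hΛ₁ : 0 < Λ z₁)
    (heq : ∀ z, z ∉ F → ∀ x, wzz z x = -(Λ z) * Literature.Analysis.FluidPDE.VectorCalculus.divergence (gradient (w z)) x) :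
    ∀ z x, fderiv ℝ (w z) x = 0 := by
  intro z
  refine fderiv_eq_zero_of_hconv_kerφ_eq_zero ((hw2 z).of_le (by norm_num)) (hb0 z) (hb1 z) fun ε N hε hN x => ?_
  -- the reverse Poincaré inequality for `φ_{ε,N}` (Files 4a′ + 4b)
  obtain ⟨C, hC⟩ := reversePoincare_of_reproducing hE (fun j => stdOrthonormalBasis ℝ E j)
    (fun j => le_of_eq ((stdOrthonormalBasis ℝ E).orthonormal.1 j)) (integrable_kerφ hε hN) (differentiable_kerφ hε hN)
    (fun j => integrable_fderiv_kerφ hε hN _) (fun j => integrable_kerK hε hN _)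
    (fun j => integrable_kerK_weight hε hN _) (kerφ_eq_sum hε hN)
  exact hconv_eq_zero_of_reversePoincare hE w wz wzz Λ F hw2 hb0 hb1 hb2 hg0 hg1 hdiv hwzc hwzzc hwzzcz hbz hbzz
    hd1 hd2 hF hΛ hz₁ hΛ₁ heq (integrable_kerφ hε hN) hC z x

end Summit.NavierStokesRegularity.NavierStokesRegularity.Theorems.PoloidalWindowDoorPoloidalWindowRigidityThmA

end
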